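import Mathlib
import Literature.MathematicalPhysics.StatisticalMechanics.LennardJonesClusters
import Summits.AtomisticToContinuum.Crystallization.Theorems.ExcessDecayLiouvilleForceBalance

/-!
# Stub `stub_nashForceBalance` of the line `birth` of the crux `NashClassCertificates.NashNearField`

Nash (best-response) configurations of pairwise distinct points are in exact Lennard-Jones force
balance at every particle: Fermat's theorem for the one-particle potential
`y ↦ Σ_{j ≠ i} V_LJ(|y − x_j|)`, which is differentiable at `y = x_i` (all `x_j ≠ x_i`) and has a
local minimum there by the Nash clause (its value at `x_i` is `siteEnergy V_LJ x i`).  The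
calculus (`D[V(|w − q|)](p) = (V′(d)/d)⟨p − q, ·⟩`, differentiability of `V_LJ` off `0`) is reused
from the landed `Theorems.ExcessDecayLiouvilleForceBalance` (ground states; here the weaker Nash
clause replaces global minimality).
-/

open scoped BigOperators RealInnerProductSpace Topology
open Literature.MathematicalPhysics.StatisticalMechanics

namespace Summit.AtomisticToContinuum.Crystallization.Theorems.NashClassCertificatesNashNearField

open Summit.AtomisticToContinuum.Crystallization.Theorems.ExcessDecayLiouvilleForceBalance in
/-- **Nash ⇒ force balance.**  In a configuration of pairwise distinct points of `ℝ³` satisfying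
the best-response (Nash) clause for the Lennard-Jones potential — no particle lowers its site
energy by relocating to a point not occupied by another particle — every particle is in exact
force balance: `Σ_{j ≠ i} (V′(r_ij)/r_ij) • (x_i − x_j) = 0`.  Fermat's theorem at the interior
local minimum `x_i` of the differentiable one-particle potential `y ↦ Σ_{j ≠ i} V(|y − x_j|)`
on the open set `{y | ∀ j ≠ i, y ≠ x_j}`. [folklore] -/
theorem stub_nashForceBalance :
    ∀ (N : ℕ) (x : Fin N → EuclideanSpace ℝ (Fin 3)),
      (∀ i j : Fin N, i ≠ j → x i ≠ x j) →
      (∀ (i : Fin N) (y : EuclideanSpace ℝ (Fin 3)), (∀ j : Fin N, j ≠ i → y ≠ x j) → siteEnergy lennardJones x i ≤ ∑ j ∈ Finset.univ.erase i, lennardJones (dist y (x j))) →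
      ∀ i : Fin N, ∑ j ∈ Finset.univ.erase i,
        (deriv lennardJones (dist (x i) (x j)) / dist (x i) (x j)) • (x i - x j) = 0 := by
  intro N x hdist hnash i
  have hne : ∀ j ∈ Finset.univ.erase i, x i ≠ x j := fun j hj =>
    hdist i j (Finset.ne_of_mem_erase hj).symm
  -- the one-particle potential and its Fréchet derivative at `x i`
  set φ : EuclideanSpace ℝ (Fin 3) → ℝ :=
    fun y => ∑ j ∈ Finset.univ.erase i, lennardJones (dist y (x j)) with hφ
  set L : EuclideanSpace ℝ (Fin 3) →L[ℝ] ℝ := ∑ j ∈ Finset.univ.erase i,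
    (deriv lennardJones (dist (x i) (x j)) / dist (x i) (x j)) • innerSL ℝ (x i - x j) with hL
  have hderiv : HasFDerivAt φ L (x i) := by
    rw [hφ, hL]
    refine HasFDerivAt.fun_sum fun j hj => ?_
    have hd : dist (x i) (x j) ≠ 0 := dist_ne_zero.2 (hne j hj)
    exact hasFDerivAt_comp_dist_left (hne j hj) (differentiableAt_lennardJones hd).hasDerivAt
  -- `x i` is a local minimum of `φ` (Nash clause on the open complement of the other points)
  have hmin : IsLocalMin φ (x i) := by
    have hU : IsOpen {y : EuclideanSpace ℝ (Fin 3) | ∀ j ∈ Finset.univ.erase i, y ≠ x j} := by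
      have hset : {y : EuclideanSpace ℝ (Fin 3) | ∀ j ∈ Finset.univ.erase i, y ≠ x j} =
          ⋂ j ∈ Finset.univ.erase i, {x j}ᶜ := by
        ext y
        simp
      rw [hset]
      exact isOpen_biInter_finset fun j _ => isOpen_compl_singleton
    have hxU : x i ∈ {y : EuclideanSpace ℝ (Fin 3) | ∀ j ∈ Finset.univ.erase i, y ≠ x j} := hne
    refine Filter.eventually_of_mem (hU.mem_nhds hxU) fun y hy => ?_
    have hy' : ∀ j : Fin N, j ≠ i → y ≠ x j := fun j hj =>
      hy j (Finset.mem_erase.2 ⟨hj, Finset.mem_univ j⟩)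
    have h := hnash i y hy'
    simpa [siteEnergy, hφ] using h
  have hL0 : L = 0 := hmin.hasFDerivAt_eq_zero hderiv
  -- the derivative is `⟪w, ·⟫` with `w` the force vector; evaluate it at `w`
  set w : EuclideanSpace ℝ (Fin 3) := ∑ j ∈ Finset.univ.erase i,
    (deriv lennardJones (dist (x i) (x j)) / dist (x i) (x j)) • (x i - x j) with hw
  have hLw : L w = ⟪w, w⟫ := by
    simp only [hL, hw, _root_.sum_apply, _root_.smul_apply, innerSL_apply_apply, sum_inner,
      inner_smul_left, smul_eq_mul, RCLike.conj_to_real]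
  have hww : ⟪w, w⟫ = 0 := by
    rw [← hLw, hL0]
    rfl
  exact inner_self_eq_zero.1 hww

end Summit.AtomisticToContinuum.Crystallization.Theorems.NashClassCertificatesNashNearField
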